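import Summits.CriticalPhenomena.PercolationContinuityZ3.Theorems.Transplant.PlanarSectorBridgeDefs
import HarnessLib

/-!
# Planar sectors, uniqueness of the infinite cluster — THE CROSS-CUT LEMMA (deterministic): an open path inside the sector from the corner
# `(X, mX)` of the upper ray down to the lower ray `{x₁ = 0}` is met by every path of the sector from `{x₀ < X}` to the far right; hence
# every infinite open cluster of `ℤ²[S_m]` meeting `{x₀ < X}` contains that corner

builds on p205010 (kernel theorem, internal audit signed; external expert review pending) — nothing in this file uses p205010.
Lane `prim-bschramm`, seat `prim-bschramm-p2` (gen 19; class C1b, sub-domains of `ℤ^d` at their own critical points, METHOD = input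
substitution); helper file (`--supports stmt-CriticalPhenomena-4575`).  Memo `P2-LATTICES.md` §51.
The chain of this generation (planar sectors `S_m = {0 ≤ x₁ ≤ m x₀} ⊂ ℤ²`, `m ≥ 1`; uniqueness of the infinite cluster at every
density and continuity of `θ`): `PlanarSectorBridgeDefs` (objects) → `PlanarSectorCrossCut` (the deterministic cross-cut lemma) →
`PlanarSectorChain` (Bollobás–Riordan's rectangle chain at one corner, `P ≥ 1/2`; the local bridge) → `PlanarSectorBridge` (the bridge
event at the corner `(X, mX)`: `P_p ≥ p^{N-1}/2` uniformly in `X`; independence in disjoint boxes; second Borel–Cantelli) →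
`PlanarSectorUniqueness` (a.s. uniqueness at EVERY `p`, continuity of `θ_{S_m}(v, ·)`, the sector row).
* §1 `exists_subwalk_strip` (passage of a walk through a vertical strip), **`crossCut_meets`**: a lattice walk `σ` inside
  `S_m ∩ {L ≤ x₀ ≤ R}` from the lower ray to the corner `(X, mX)` (`L ≤ X ≤ R`) meets every lattice walk `π` inside `S_m` from `{x₀ < L}`
  to `{x₀ > R}` — the passage of `π` is a left-right crossing of `[L, R] × [0, mR]`, `σ` followed by the vertical segment above the corner
  is a top-bottom crossing, two such crossings share a vertex (`exists_mem_support_of_crossing`, the discrete Jordan curve theorem of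
  `PlanarDuality`), and a shared vertex strictly above the corner would lie outside the sector.
* §2 `support_subset_of_edges_mem_withinGraph`, `edges_mem_withinGraph_of_support`, `mem_of_percolatesAt_of_subset`,
  `openCluster_subset_of_subset` (walks / clusters along the edges of `withinGraph G S` stay in `S`), `exists_mem_openCluster_gt` (an
  infinite cluster of the sector is unbounded to the right: `S_m ∩ {x₀ ≤ R}` is finite), **`reachable_corner_of_bridge`**: for
  `ω ⊆ E(ℤ²)`, every vertex `x` with `x₀ < X` percolating in `ω ∩ E(ℤ²[S_m])` is joined in `ω ∩ E(ℤ²[S_m])` to the corner of any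
  `ω`-open bridge at `X`.
[cite: BollobasRiordan2006, Ch. 3, Thm. 10 (proof: "this path must meet")] [cite: KestenPercolation1982, §2.2] [cite: GrimmettPercolation1999, §11.5 notes p. 347]
-/

noncomputable section

namespace Summit.CriticalPhenomena.PercolationContinuityZ3.Theorems.Transplant

namespace PlanarSector

open MeasureTheory ProbabilityTheory Literature.Probability.Percolation Literature.Probability.LatticeModels SimpleGraph
  PlanarDuality Filter
open scoped Classical ENNReal Topology

/-! ## §1 The cross-cut lemma -/

/-- **Passage through a strip.** A lattice walk from `{x₀ < L}` to `{x₀ > R}` (`L ≤ R`) contains a sub-walk inside the strip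
`{L ≤ x₀ ≤ R}` from the line `x₀ = L` to the line `x₀ = R` (last exit from `{x₀ ≤ L}`… first arrival at `{x₀ ≥ R}`). [folklore] -/
theorem exists_subwalk_strip {u w : Site 2} (π : (zdGraph 2).Walk u w) {L R : ℤ} (hLR : L ≤ R) (hu : u 0 < L) (hw : R < w 0) :
    ∃ a b, ∃ P : (zdGraph 2).Walk a b, a 0 = L ∧ b 0 = R ∧ (∀ z ∈ P.support, z ∈ π.support) ∧
      ∀ z ∈ P.support, L ≤ z 0 ∧ z 0 ≤ R := by
  obtain ⟨f, g, hf, hg, hfg, W₁, hW₁supp, -, hW₁S⟩ :=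
    exists_prefix_within_edges {z : Site 2 | L ≤ z 0} π.reverse (show L ≤ w 0 by omega) (show ¬ L ≤ u 0 by omega)
  have hf0 : f 0 = L := by
    have h1 : L ≤ f 0 := hf
    have h2 : ¬ L ≤ g 0 := hg
    have := zdGraph_adj_apply_le hfg 0
    omega
  obtain ⟨f', g', hf', hg', hfg', W₂, hW₂supp, -, hW₂S⟩ :=
    exists_prefix_within_edges {z : Site 2 | z 0 ≤ R} W₁.reverse (show f 0 ≤ R by omega) (show ¬ w 0 ≤ R by omega)
  have hf'0 : f' 0 = R := by
    have h1 : f' 0 ≤ R := hf'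
    have h2 : ¬ g' 0 ≤ R := hg'
    have := zdGraph_adj_apply_le hfg' 0
    omega
  have hW₂W₁ : ∀ z ∈ W₂.support, z ∈ W₁.support := fun z hz => by
    have h1 := hW₂supp z hz
    rwa [Walk.support_reverse, List.mem_reverse] at h1
  refine ⟨f, f', W₂, hf0, hf'0, fun z hz => ?_, fun z hz => ⟨hW₁S z (hW₂W₁ z hz), hW₂S z hz⟩⟩
  have h2 := hW₁supp z (hW₂W₁ z hz)
  rwa [Walk.support_reverse, List.mem_reverse] at h2

/-- **THE CROSS-CUT LEMMA.** Let `σ` be a lattice walk inside `S_m ∩ {L ≤ x₀ ≤ R}` from a point `b` of the lower ray `{x₁ = 0}` to the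
corner `(X, mX)` of the upper ray, `L ≤ X ≤ R`.  Then every lattice walk `π` inside `S_m` from `{x₀ < L}` to `{x₀ > R}` meets `σ`:
the passage of `π` through the strip is a left-right crossing of the box `[L, R] × [0, mR]`, `σ` followed by the vertical segment from
the corner up to height `mR` is a top-bottom crossing of it, two such crossings share a vertex (`exists_mem_support_of_crossing`, the
discrete Jordan curve theorem), and a shared vertex strictly above the corner would lie outside the sector. [folklore] -/
theorem crossCut_meets {m : ℕ} {X L R : ℤ} (hLX : L ≤ X) (hXR : X ≤ R) (hX : 0 ≤ X) {b : Site 2} (hb : b 1 = 0)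
    (σ : (zdGraph 2).Walk b (corner m X)) (hσS : ∀ z ∈ σ.support, z ∈ sector m)
    (hσ : ∀ z ∈ σ.support, L ≤ z 0 ∧ z 0 ≤ R) {u w : Site 2} (π : (zdGraph 2).Walk u w)
    (hπ : ∀ z ∈ π.support, z ∈ sector m) (hu : u 0 < L) (hw : R < w 0) :
    ∃ z ∈ π.support, z ∈ σ.support := by
  have hm0 : (0 : ℤ) ≤ m := by positivity
  set T : ℤ := (m : ℤ) * R with hT
  -- the passage of `π` through the strip
  obtain ⟨a, a', P, ha, ha', hPπ, hPstrip⟩ := exists_subwalk_strip π (hLX.trans hXR) hu hw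
  have hPbox : ∀ z ∈ P.support, L ≤ z 0 ∧ z 0 ≤ R ∧ 0 ≤ z 1 ∧ z 1 ≤ T := by
    intro z hz
    obtain ⟨h1, h2⟩ := hPstrip z hz
    obtain ⟨h3, h4⟩ := hπ z (hPπ z hz)
    exact ⟨h1, h2, h3, h4.trans (by rw [hT]; exact mul_le_mul_of_nonneg_left h2 hm0)⟩
  -- the vertical segment from `(X, T)` down to the corner
  set top : Site 2 := ![X, T] with htop
  set k : ℕ := (T - (m : ℤ) * X).toNat with hk
  have hkT : (k : ℤ) = T - (m : ℤ) * X := by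
    rw [hk, Int.toNat_of_nonneg]; rw [hT]; nlinarith
  have hend : (fun w : Site 2 => w - Pi.single 1 1)^[k] top = corner m X := by
    rw [Site.eq_iff_two, iterate_sub_single_apply_zero, iterate_sub_single_apply_one, hkT]
    simp [htop, corner]
  set V : (zdGraph 2).Walk (corner m X) top := ((downRun top k).reverse).copy hend rfl with hV
  have hVsupp : ∀ z ∈ V.support, z 0 = X ∧ (m : ℤ) * X ≤ z 1 ∧ z 1 ≤ T := by
    intro z hz
    rw [hV, Walk.support_copy, Walk.support_reverse, List.mem_reverse, mem_support_downRun, hkT] at hz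
    simp only [htop, Matrix.cons_val_zero, Matrix.cons_val_one] at hz
    refine ⟨hz.1, by linarith [hz.2.1], hz.2.2⟩
  set Q : (zdGraph 2).Walk b top := σ.append V with hQ
  have hQbox : ∀ z ∈ Q.support, L ≤ z 0 ∧ z 0 ≤ R ∧ 0 ≤ z 1 ∧ z 1 ≤ T := by
    intro z hz
    rw [hQ, Walk.mem_support_append_iff] at hz
    rcases hz with hz | hz
    · obtain ⟨h1, h2⟩ := hσ z hz
      obtain ⟨h3, h4⟩ := hσS z hz
      exact ⟨h1, h2, h3, h4.trans (by rw [hT]; exact mul_le_mul_of_nonneg_left h2 hm0)⟩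
    · obtain ⟨h1, h2, h3⟩ := hVsupp z hz
      exact ⟨by omega, by omega, le_trans (by positivity) h2, h3⟩
  have htop1 : top 1 = T := by simp [htop]
  obtain ⟨z, hzP, hzQ⟩ := exists_mem_support_of_crossing (L := L) (R := R) (B := 0) (T := T) P Q hPbox hQbox ha ha' hb htop1
  refine ⟨z, hPπ z hzP, ?_⟩
  rw [hQ, Walk.mem_support_append_iff] at hzQ
  rcases hzQ with hzQ | hzQ
  · exact hzQ
  · -- a meeting point on the vertical segment is the corner itself
    obtain ⟨h1, h2, -⟩ := hVsupp z hzQ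
    obtain ⟨-, h4⟩ := hπ z (hPπ z hzP)
    rw [h1] at h4
    have hz : z = corner m X := by
      rw [Site.eq_iff_two]; simp [corner]; exact ⟨h1, le_antisymm h4 h2⟩
    rw [hz]
    exact σ.end_mem_support

/-! ## §2 Every infinite cluster meeting `{x₀ < X}` contains the corner of every bridge at `X` -/

section Clusters

variable {V : Type*} {G : SimpleGraph V}

/-- A walk starting in `S` along edges of `withinGraph G S` stays in `S`. [folklore] -/
theorem support_subset_of_edges_mem_withinGraph {S : Set V} {a b : V} (P : G.Walk a b) (ha : a ∈ S)
    (hP : ∀ e ∈ P.edges, e ∈ (withinGraph G S).edgeSet) : ∀ z ∈ P.support, z ∈ S := by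
  induction P with
  | nil => intro z hz; rw [Walk.support_nil, List.mem_singleton] at hz; exact hz ▸ ha
  | @cons u v w h P ih =>
    intro z hz
    rw [Walk.support_cons, List.mem_cons] at hz
    have huv : s(u, v) ∈ (withinGraph G S).edgeSet := hP _ (by rw [Walk.edges_cons]; exact List.mem_cons_self)
    have hv : v ∈ S := (mem_edgeSet_withinGraph.1 huv).2.2
    rcases hz with rfl | hz
    · exact ha
    · exact ih hv (fun e he => hP e (by rw [Walk.edges_cons]; exact List.mem_cons_of_mem _ he)) z hz

/-- The edges of a walk inside `S` are edges of `withinGraph G S`. [folklore] -/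
theorem edges_mem_withinGraph_of_support {S : Set V} {a b : V} (P : G.Walk a b) (hS : ∀ z ∈ P.support, z ∈ S) :
    ∀ e ∈ P.edges, e ∈ (withinGraph G S).edgeSet := by
  induction P with
  | nil => intro e he; simp at he
  | @cons u v w h P ih =>
    intro e he
    rw [Walk.edges_cons, List.mem_cons] at he
    have hu : u ∈ S := hS u (Walk.start_mem_support _)
    have hS' : ∀ z ∈ P.support, z ∈ S := fun z hz => hS z (by rw [Walk.support_cons]; exact List.mem_cons_of_mem _ hz)
    rcases he with rfl | he
    · exact mem_edgeSet_withinGraph.2 ⟨h, hu, hS' v (Walk.start_mem_support _)⟩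
    · exact ih hS' e he

/-- A vertex percolating in a configuration carried by `withinGraph G S` lies in `S` (its cluster has a first edge). [folklore] -/
theorem mem_of_percolatesAt_of_subset {S : Set V} {ω : BondConfig V} (hω : ω ⊆ (withinGraph G S).edgeSet) {x : V}
    (hx : ω ∈ percolatesAt x) : x ∈ S := by
  have hinf : (openCluster ω x).Infinite := hx
  obtain ⟨y, hy, hyx⟩ := Set.Infinite.exists_notMem_finset hinf {x}
  rw [Finset.mem_singleton] at hyx
  obtain ⟨W⟩ := (show (openGraph ω).Reachable x y from hy)
  cases W with
  | nil => exact absurd rfl hyx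
  | cons h _ =>
    have h' := (openGraph_adj ω _ _).1 h
    exact (mem_edgeSet_withinGraph.1 (hω h'.1)).2.1

/-- Every vertex of the open cluster of a percolating vertex lies in `S`. [folklore] -/
theorem openCluster_subset_of_subset {S : Set V} {ω : BondConfig V} (hω : ω ⊆ (withinGraph G S).edgeSet) {x : V}
    (hx : ω ∈ percolatesAt x) : openCluster ω x ⊆ S := by
  intro y hy
  obtain ⟨W⟩ := (show (openGraph ω).Reachable x y from hy)
  cases hW : W.reverse with
  | nil => exact mem_of_percolatesAt_of_subset hω hx
  | cons h _ =>
    have h' := (openGraph_adj ω _ _).1 h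
    exact (mem_edgeSet_withinGraph.1 (hω h'.1)).2.1

end Clusters

/-- **An infinite cluster of the sector is unbounded to the right**: `S_m ∩ {x₀ ≤ R}` is finite (`m ≥ 1`). [folklore] -/
theorem exists_mem_openCluster_gt {m : ℕ} (hm : 1 ≤ m) {ω : BondConfig (Site 2)}
    (hω : ω ⊆ (withinGraph (zdGraph 2) (sector m)).edgeSet) {x : Site 2} (hx : ω ∈ percolatesAt x) (R : ℤ) :
    ∃ w ∈ openCluster ω x, R < w 0 := by
  by_contra hcon
  push Not at hcon
  have hsub : openCluster ω x ⊆ ↑(Finset.Icc (0 : Site 2) ![R, (m : ℤ) * R]) := by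
    intro z hz
    have hzS := openCluster_subset_of_subset hω hx hz
    have hz0 : 0 ≤ z 0 := sector_subset_halfSpace hm hzS
    obtain ⟨hz1, hz2⟩ := hzS
    have hzR := hcon z hz
    have hm0 : (0 : ℤ) ≤ m := by positivity
    rw [Finset.mem_coe, Finset.mem_Icc]
    refine ⟨fun i => ?_, fun i => ?_⟩ <;> fin_cases i <;> simp
    · exact hz0
    · exact hz1
    · exact hzR
    · exact hz2.trans (mul_le_mul_of_nonneg_left hzR hm0)
  exact hx ((Finset.finite_toSet _).subset hsub)

/-- **Every infinite open cluster of `ℤ²[S_m]` containing a vertex of `{x₀ < X}` contains the corner `(X, mX)` of every bridge at `X`.**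
Here `ω ⊆ E(ℤ²)`, the clusters are those of `ω ∩ E(ℤ²[S_m])`, and a bridge is an `ω`-open path from the corner to the lower ray
inside a set `D ⊆ S_m ∩ {X ≤ x₀ ≤ R}`.  (The cluster leaves `{x₀ ≤ R}`, so one of its open paths crosses the strip and meets the bridge by
the cross-cut lemma; the bridge is open in `ω ∩ E(ℤ²[S_m])` because it runs inside `S_m`.) [folklore] -/
theorem reachable_corner_of_bridge {m : ℕ} (hm : 1 ≤ m) {ω : BondConfig (Site 2)} (hω : ω ⊆ (zdGraph 2).edgeSet)
    {X R : ℤ} (hX : 0 ≤ X) (hXR : X ≤ R) {D : Set (Site 2)} (hD : ∀ z ∈ D, z ∈ sector m ∧ X ≤ z 0 ∧ z 0 ≤ R)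
    {b : Site 2} (hb : b 1 = 0) (hbridge : ω ∈ openConnIn D (corner m X) b) {x : Site 2} (hxX : x 0 < X)
    (hx : ω ∩ (withinGraph (zdGraph 2) (sector m)).edgeSet ∈ percolatesAt x) :
    (openGraph (ω ∩ (withinGraph (zdGraph 2) (sector m)).edgeSet)).Reachable x (corner m X) := by
  set ω' := ω ∩ (withinGraph (zdGraph 2) (sector m)).edgeSet with hω'
  have hω'E : ω' ⊆ (withinGraph (zdGraph 2) (sector m)).edgeSet := Set.inter_subset_right
  have hω'G : ω' ⊆ (zdGraph 2).edgeSet := fun e he => hω he.1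
  -- a far vertex of the cluster of `x`, an `ω'`-open lattice walk to it inside the sector
  obtain ⟨w, hw, hRw⟩ := exists_mem_openCluster_gt hm hω'E hx R
  obtain ⟨π, -, hπω⟩ := exists_walk_of_mem_openConnIn hω'G (openConnIn_univ_of_reachable hw)
  have hxS : x ∈ sector m := mem_of_percolatesAt_of_subset hω'E hx
  have hπS : ∀ z ∈ π.support, z ∈ sector m :=
    support_subset_of_edges_mem_withinGraph π hxS fun e he => hω'E (hπω e he)
  -- the bridge as a lattice walk
  obtain ⟨σ₀, hσ₀D, hσ₀ω⟩ := exists_walk_of_mem_openConnIn hω hbridge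
  have hσS : ∀ z ∈ σ₀.reverse.support, z ∈ sector m := fun z hz => by
    rw [Walk.support_reverse, List.mem_reverse] at hz; exact (hD z (hσ₀D z hz)).1
  have hσstrip : ∀ z ∈ σ₀.reverse.support, X ≤ z 0 ∧ z 0 ≤ R := fun z hz => by
    rw [Walk.support_reverse, List.mem_reverse] at hz; exact (hD z (hσ₀D z hz)).2
  obtain ⟨z, hzπ, hzσ⟩ := crossCut_meets le_rfl hXR hX hb σ₀.reverse hσS hσstrip π hπS hxX hRw
  rw [Walk.support_reverse, List.mem_reverse] at hzσ
  -- `x ↔ z` along `π`, `z ↔ corner` along the bridge (open in `ω'` since inside the sector)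
  have h1 : (openGraph ω').Reachable x z := by
    obtain ⟨hx', hz', hr⟩ := mem_openConnIn_of_mem_support π (S := Set.univ) (fun _ _ => Set.mem_univ _) hπω hzπ
    exact hr.map (Embedding.induce (Set.univ : Set (Site 2))).toHom
  have hσ₀ω' : ∀ e ∈ σ₀.edges, e ∈ ω' := fun e he =>
    ⟨hσ₀ω e he, edges_mem_withinGraph_of_support σ₀ (fun z hz => (hD z (hσ₀D z hz)).1) e he⟩
  have h2 : (openGraph ω').Reachable (corner m X) z := by
    obtain ⟨hc', hz', hr⟩ := mem_openConnIn_of_mem_support σ₀ hσ₀D hσ₀ω' hzσ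
    exact hr.map (Embedding.induce D).toHom
  exact h1.trans h2.symm

end PlanarSector

end Summit.CriticalPhenomena.PercolationContinuityZ3.Theorems.Transplant

end
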